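import Summits.Ventures.PercRepro.C026PFunTwoLiveAdjacent

/-!
# The corner identity `(E00)` as a counting inequality (p6, gen 18)

What remains of the `k = 2` problem of CONJECTURE (P) is the corner identity `(E00)`:
`0 ≤ (P)(0,0)` at the all-corner cells `liveCells a b` of the skeleton `(G; a, b, c)` — THEOREM L2
(`C026PFunTwoLiveL2`, `C026PFunCurveL2`) turns it into `(P) ≥ 0` at every band state of the probe and
of the two live vertices.  This file records, kernel-checked, exactly which counting inequality `(E00)`
is (mine-3 §36 (b)) — with the (red, blue) type counts `n(X,Y)` of the triple `(c, a, b)`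
(`A = c|a|b`, `B` = `c` joined to exactly one of `a, b`, `C = ab|c`, `D = cab`; red = the
configuration, blue = its complement):

* `pFun_liveCells_nonneg_iff`: `(E00) ⟺ n(D,A) ≤ 2·|B| + 2·n(B,C) + n(D,¬A)`;
* `pFun_liveCells_nonneg_of_two_mul`: `n(D,A) ≤ 2·|B|` ⟹ `(E00)` — the lossy form
  «every `(D,A)` configuration has two `B`-configurations to pay for it» (mine-3 §36 (b), room 4/3 in the
  censuses), which is what the explicit charging rules of proofs/P6-E00-CLASSES.md §4 establish on every
  configuration they serve;
* `pFun_liveCells_nonneg_of_le_add`: `n(D,A) ≤ |B| + n(D,C)` ⟹ `(E00)` — the tight strengthening of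
  mine-3's `(I)` recorded in proofs/P6-E00-CLASSES.md §2 (CONJECTURE (S11), 0 violations).

Everything is a rearrangement of `pFun_liveCells_eq_types` (`C026PFunTwoLiveAdjacent`) with the
complementation bijection `card_filter_compl_eq` and the split `n(D,·) = n(D,A) + n(D,¬A)`.
-/

namespace PercRepro

namespace MultiGraph

open Finset

variable {V E : Type*} [Fintype V] [DecidableEq V] [Fintype E] [DecidableEq E]
  {G : MultiGraph V E}

omit [Fintype V] [DecidableEq V] in
open Classical in
/-- `n(D,·) = n(D,A) + n(D,¬A)`: the configurations of red type `D` split by their blue type. -/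
theorem card_D_eq_add (a b c : V) :
    (univ.filter fun ω : Config E => G.Conn ω c a ∧ G.Conn ω c b).card =
      (univ.filter fun ω : Config E => (G.Conn ω c a ∧ G.Conn ω c b) ∧
        (¬ G.Conn ωᶜ c a ∧ ¬ G.Conn ωᶜ c b ∧ ¬ G.Conn ωᶜ a b)).card +
      (univ.filter fun ω : Config E => (G.Conn ω c a ∧ G.Conn ω c b) ∧
        (G.Conn ωᶜ c a ∨ G.Conn ωᶜ c b ∨ G.Conn ωᶜ a b)).card := by
  rw [← Finset.card_filter_add_card_filter_not
    (s := univ.filter fun ω : Config E => G.Conn ω c a ∧ G.Conn ω c b)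
    (fun ω : Config E => ¬ G.Conn ωᶜ c a ∧ ¬ G.Conn ωᶜ c b ∧ ¬ G.Conn ωᶜ a b)]
  rw [Finset.filter_filter, Finset.filter_filter]
  congr 2
  apply Finset.filter_congr
  intro ω _
  constructor
  · rintro ⟨h1, h2⟩
    exact ⟨h1, by tauto⟩
  · rintro ⟨h1, h2⟩
    exact ⟨h1, by tauto⟩

open Classical in
/-- **`(E00)` is a counting inequality** (mine-3 §36 (b)): the `k = 2` all-corner value of `(P)` is
nonnegative iff `n(D,A) ≤ 2·|B| + 2·n(B,C) + n(D,¬A)`. -/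
theorem pFun_liveCells_nonneg_iff (a b c : V) :
    0 ≤ G.pFun c (liveCells a b) (liveCells a b) univ ↔
      (univ.filter fun ω : Config E => (G.Conn ω c a ∧ G.Conn ω c b) ∧
          (¬ G.Conn ωᶜ c a ∧ ¬ G.Conn ωᶜ c b ∧ ¬ G.Conn ωᶜ a b)).card ≤
        2 * (univ.filter fun ω : Config E =>
            (G.Conn ω c a ∧ ¬ G.Conn ω c b) ∨ (G.Conn ω c b ∧ ¬ G.Conn ω c a)).card +
        2 * (univ.filter fun ω : Config E =>
            ((G.Conn ω c a ∧ ¬ G.Conn ω c b) ∨ (G.Conn ω c b ∧ ¬ G.Conn ω c a)) ∧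
            (G.Conn ωᶜ a b ∧ ¬ G.Conn ωᶜ c a)).card +
        (univ.filter fun ω : Config E => (G.Conn ω c a ∧ G.Conn ω c b) ∧
          (G.Conn ωᶜ c a ∨ G.Conn ωᶜ c b ∨ G.Conn ωᶜ a b)).card := by
  rw [pFun_liveCells_eq_types]
  -- `n(C,D) = n(D,C)` and `n(C,B) = n(B,C)` by complementation
  have h1 : (univ.filter fun ω : Config E => (G.Conn ω a b ∧ ¬ G.Conn ω c a) ∧
        (G.Conn ωᶜ c a ∧ G.Conn ωᶜ c b)).card =
      (univ.filter fun ω : Config E => (G.Conn ω c a ∧ G.Conn ω c b) ∧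
        (G.Conn ωᶜ a b ∧ ¬ G.Conn ωᶜ c a)).card :=
    card_filter_compl_eq _ _ fun ω => by
      simp only [compl_compl]
      exact and_comm
  have h2 : (univ.filter fun ω : Config E => (G.Conn ω a b ∧ ¬ G.Conn ω c a) ∧
        ((G.Conn ωᶜ c a ∧ ¬ G.Conn ωᶜ c b) ∨ (G.Conn ωᶜ c b ∧ ¬ G.Conn ωᶜ c a))).card =
      (univ.filter fun ω : Config E =>
        ((G.Conn ω c a ∧ ¬ G.Conn ω c b) ∨ (G.Conn ω c b ∧ ¬ G.Conn ω c a)) ∧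
        (G.Conn ωᶜ a b ∧ ¬ G.Conn ωᶜ c a)).card :=
    card_filter_compl_eq _ _ fun ω => by
      simp only [compl_compl]
      exact and_comm
  have h3 := card_D_eq_add (G := G) a b c
  rw [h1, h2, h3]
  push_cast
  constructor
  · intro h
    have : ((univ.filter fun ω : Config E => (G.Conn ω c a ∧ G.Conn ω c b) ∧
        (¬ G.Conn ωᶜ c a ∧ ¬ G.Conn ωᶜ c b ∧ ¬ G.Conn ωᶜ a b)).card : ℝ) ≤
        2 * ((univ.filter fun ω : Config E =>
            (G.Conn ω c a ∧ ¬ G.Conn ω c b) ∨ (G.Conn ω c b ∧ ¬ G.Conn ω c a)).card : ℝ) +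
        2 * ((univ.filter fun ω : Config E =>
            ((G.Conn ω c a ∧ ¬ G.Conn ω c b) ∨ (G.Conn ω c b ∧ ¬ G.Conn ω c a)) ∧
            (G.Conn ωᶜ a b ∧ ¬ G.Conn ωᶜ c a)).card : ℝ) +
        ((univ.filter fun ω : Config E => (G.Conn ω c a ∧ G.Conn ω c b) ∧
          (G.Conn ωᶜ c a ∨ G.Conn ωᶜ c b ∨ G.Conn ωᶜ a b)).card : ℝ) := by linarith
    exact_mod_cast this
  · intro h
    have : ((univ.filter fun ω : Config E => (G.Conn ω c a ∧ G.Conn ω c b) ∧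
        (¬ G.Conn ωᶜ c a ∧ ¬ G.Conn ωᶜ c b ∧ ¬ G.Conn ωᶜ a b)).card : ℝ) ≤
        2 * ((univ.filter fun ω : Config E =>
            (G.Conn ω c a ∧ ¬ G.Conn ω c b) ∨ (G.Conn ω c b ∧ ¬ G.Conn ω c a)).card : ℝ) +
        2 * ((univ.filter fun ω : Config E =>
            ((G.Conn ω c a ∧ ¬ G.Conn ω c b) ∨ (G.Conn ω c b ∧ ¬ G.Conn ω c a)) ∧
            (G.Conn ωᶜ a b ∧ ¬ G.Conn ωᶜ c a)).card : ℝ) +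
        ((univ.filter fun ω : Config E => (G.Conn ω c a ∧ G.Conn ω c b) ∧
          (G.Conn ωᶜ c a ∨ G.Conn ωᶜ c b ∨ G.Conn ωᶜ a b)).card : ℝ) := by exact_mod_cast h
    linarith

open Classical in
/-- **The lossy sufficient condition** `n(D,A) ≤ 2·|B|` ⟹ `(E00)` (mine-3 §36 (b)): two red-`B`
configurations per `(D,A)` configuration pay the corner identity. -/
theorem pFun_liveCells_nonneg_of_two_mul (a b c : V)
    (h : (univ.filter fun ω : Config E => (G.Conn ω c a ∧ G.Conn ω c b) ∧
          (¬ G.Conn ωᶜ c a ∧ ¬ G.Conn ωᶜ c b ∧ ¬ G.Conn ωᶜ a b)).card ≤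
        2 * (univ.filter fun ω : Config E =>
            (G.Conn ω c a ∧ ¬ G.Conn ω c b) ∨ (G.Conn ω c b ∧ ¬ G.Conn ω c a)).card) :
    0 ≤ G.pFun c (liveCells a b) (liveCells a b) univ := by
  rw [pFun_liveCells_nonneg_iff]
  omega

open Classical in
/-- **The tight sufficient condition** `n(D,A) ≤ |B| + n(D,C)` ⟹ `(E00)` (CONJECTURE (S11) of
proofs/P6-E00-CLASSES.md §2; on skeletons with adjacent live vertices it is the terminal-edge
injection `card_DA_le_of_edge`). -/
theorem pFun_liveCells_nonneg_of_le_add (a b c : V)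
    (h : (univ.filter fun ω : Config E => (G.Conn ω c a ∧ G.Conn ω c b) ∧
          (¬ G.Conn ωᶜ c a ∧ ¬ G.Conn ωᶜ c b ∧ ¬ G.Conn ωᶜ a b)).card ≤
        (univ.filter fun ω : Config E =>
            (G.Conn ω c a ∧ ¬ G.Conn ω c b) ∨ (G.Conn ω c b ∧ ¬ G.Conn ω c a)).card +
        (univ.filter fun ω : Config E => (G.Conn ω c a ∧ G.Conn ω c b) ∧
          (G.Conn ωᶜ a b ∧ ¬ G.Conn ωᶜ c a)).card) :
    0 ≤ G.pFun c (liveCells a b) (liveCells a b) univ := by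
  rw [pFun_liveCells_nonneg_iff]
  -- `n(D,C) ≤ n(D,¬A)`: the blue type `C` is one of the blue types other than `A`
  have hsub : (univ.filter fun ω : Config E => (G.Conn ω c a ∧ G.Conn ω c b) ∧
        (G.Conn ωᶜ a b ∧ ¬ G.Conn ωᶜ c a)).card ≤
      (univ.filter fun ω : Config E => (G.Conn ω c a ∧ G.Conn ω c b) ∧
        (G.Conn ωᶜ c a ∨ G.Conn ωᶜ c b ∨ G.Conn ωᶜ a b)).card := by
    apply Finset.card_le_card
    intro ω hω
    simp only [mem_filter, mem_univ, true_and] at hω ⊢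
    exact ⟨hω.1, Or.inr (Or.inr hω.2.1)⟩
  omega

end MultiGraph

end PercRepro
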